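import Literature.NumberTheory.EllipticCurves.ModularParamFormalLogProofs
import Literature.NumberTheory.EllipticCurves.ModularParamIntegralityProofs
import Literature.NumberTheory.EllipticCurves.FormalGroupVariableChangeProofs
import Literature.NumberTheory.EllipticCurves.FormalGroupDictionaryProofs
import Literature.NumberTheory.EllipticCurves.FormalGroupFiniteHeightProofs
import Literature.NumberTheory.EllipticCurves.FormalLogExpBaseChangeProofs
import Literature.NumberTheory.EllipticCurves.PadicSigmaVariableChangeProofs
import HarnessLib

/-!
# The `x,y`-dictionary of the modular parametrisation at `∞`: `w_E(z(q)) = −1/Y(q)`, and the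
# transport of `z` to any `ℚ`-model has bounded denominators (proofs only)

Topic `NumberTheory/EllipticCurves` (theorems only; no definition, no named fact). Sequel of
`ModularParamFormalLogProofs` (`log_E(z(q)) = Σ aₙqⁿ/n` for the local parameter `z = −X/Y` of
`E : Y² = X³ + a₄X + a₆` along `τ ↦ (X(τ), Y(τ)) = (℘_Λ(u), ℘_Λ'(u)/2)`, `u = 2πi∫f`) and of
`ModularParamIntegralityProofs` (`z ∈ ℚ⟦q⟧ ∩ Frac ℤ⟦q⟧`). We complete the dictionary between the
formal group of `E` and the actual point `(X(q), Y(q)) ∈ E(ℂ((q)))`: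

* `formalW_subst_eq_of_ode`, `IsXPresentation.exists_formalLog_subst_eq_formalW` — **`w_E(z(q)) =
  −1/Y(q)`**, in the cleared form `a · w_E(z) = b · z` (`X = a/b`, `z = −X/Y`, `w_E = formalW` the
  series `w(z) = z³ + ⋯` of Silverman AEC IV.1): the proof of `formalLog_subst_eq_of_ode` shows
  `b · X_E(z) = z² · a` for the pole-cleared coordinate `X_E = z²x(z) = formalXMulSq` (both sides
  solve `T² = T³ + a₄z⁴T + a₆z⁶`, `T(0) = 1`), and `X_E · w = z³`;
* `exists_rat_series_formalLog_subst_eq_formalW` — hence, over `ℚ` (integral `aₙ(f)`,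
  `g₂, g₃ ∈ ℚ`): `z ∈ ℚ⟦q⟧`, `z · Q = P` AND `w_E(z) · Q₂ = P₂` with `P, Q, P₂, Q₂ ∈ ℤ⟦q⟧`,
  `Q, Q₂ ≠ 0`, `log_E(z) = Σ aₙqⁿ/n`;
* `exists_int_frac_formalVariableChange_subst` — **transport**: for any admissible change of
  variables `vc = (u, r, s, t)` over `ℚ`, the parameter `t' = θ_vc(z) = u(z − r w(z))/(1 + sz +
  (t − sr)w(z))` of `vc • E` (`FormalGroupVariableChangeProofs`) again satisfies `t' · Q' = P'` with
  `P', Q' ∈ ℤ⟦q⟧`, `Q' ≠ 0` (it is `−X'/Y'` for the transformed point); and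
  `formalLog_subst_formalVariableChange_subst`: `log_{vc • E}(t') = u · log_E(z)`.

This removes the short Weierstrass model (and with it the restriction `p ≥ 5`) from the transport
step of the finite-height route to the integrality of the Manin constant
(`ManinConstantGoodPrimesProofs`, step 3; fact `edixhoven_int_of_neronLattice_eq_smul_periodLattice`
of `NeronIsogenyScaling.lean`): the local lemma `padicInt_exists_map_eq_of_subst_eq_map` can be
applied to `[d]_{W'}` at `t'` directly, at every prime of finite height (sequel
`ManinConstantFiniteHeightPrimesProofs`).

## References

* T. Honda, *On the theory of commutative formal groups*, J. Math. Soc. Japan 22 (1970), §6.2,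
  pp. 241–242 (`φ(q)` = the `q`-expansion of a local parameter at the origin). [Honda1970]
* J. E. Cremona, *Algorithms for modular elliptic curves*, 2nd ed. (1997), §2.10 (`x = ℘(u)`,
  `y = ℘'(u)`). [CremonaAlgorithms1997]
* J. H. Silverman, *The Arithmetic of Elliptic Curves*, 2nd ed. (2009), III.1 (changes of
  variables), IV.1 (`z = −x/y`, `w = −1/y`, `x = z/w`). [SilvermanAEC2009]
* G. Shimura, *Introduction to the arithmetic theory of automorphic functions* (1971), Thm. 3.52,
  Thm. 7.14. [ShimuraIATAF1971]
-/

noncomputable section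

open Complex Filter Topology Set Function PowerSeries
open UpperHalfPlane hiding I
open scoped Real Topology Manifold MatrixGroups PeriodPair ModularForm WithZero
open ModularForm CongruenceSubgroup

open Literature.NumberTheory.EllipticCurves

namespace Literature.NumberTheory.EllipticCurves.ModularForms

/-! ### The core identity: `a · w_E(z) = b · z` from the cleared Weierstrass equation -/

section Core

/-- **`w_E(z(q)) = −1/Y(q)`, formal version.** In the setting of `formalLog_subst_eq_of_ode`
(`a, b, e ∈ ℂ⟦q⟧` nonzero, `a(0) = e(0) = 0`, `ord a < ord b`, the cleared Weierstrass equation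
`(bθa − aθb)² = 4e²b(a³ + a₄ab² + a₆b³)`, and `z·(bθa − aθb) = −2abe`, i.e. `z = −X/Y` for
`X = a/b`, `Y = θX/(2e)`), the series `w = formalW` of `E : Y² = X³ + a₄X + a₆` (`w(z) = z³ + ⋯`,
Silverman AEC IV.1.1) satisfies **`a · w(z(q)) = b · z(q)`**, i.e. `w(z(q)) = z/X = −1/Y` — the
formal point `(z, w(z))` IS the point `(X(q), Y(q))`. (From the proof of
`formalLog_subst_eq_of_ode`: `b·X_E(z) = z²·a` for `X_E = z²x(z)`, and `X_E·w = z³`.)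
[cite: SilvermanAEC2009, IV.1.1] [cite: Honda1970, §6.2 (pp. 241–242)] -/
theorem formalW_subst_eq_of_ode (a₄ a₆ : ℂ) {a b e z : ℂ⟦X⟧} (ha : a ≠ 0) (hb : b ≠ 0)
    (he : e ≠ 0) (ha0 : constantCoeff a = 0) (he0 : constantCoeff e = 0)
    (hord : a.order.toNat < b.order.toNat)
    (hode : (b * thetaPS a - a * thetaPS b) ^ 2 =
      4 * e ^ 2 * b * (a ^ 3 + C a₄ * a * b ^ 2 + C a₆ * b ^ 3))
    (hz : z * (b * thetaPS a - a * thetaPS b) = -2 * a * b * e) :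
    a * ({ a₁ := 0, a₂ := 0, a₃ := 0, a₄ := a₄, a₆ := a₆ } : WeierstrassCurve ℂ).formalW.subst z =
      b * z := by
  set W : WeierstrassCurve ℂ := { a₁ := 0, a₂ := 0, a₃ := 0, a₄ := a₄, a₆ := a₆ } with hW
  -- Step 0: factor out the orders
  obtain ⟨A, hA0, haA⟩ := exists_eq_X_pow_mul ha
  obtain ⟨B, hB0, hbB⟩ := exists_eq_X_pow_mul hb
  obtain ⟨E, hE0, heE⟩ := exists_eq_X_pow_mul he
  set ma := a.order.toNat with hma
  set mb := b.order.toNat with hmb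
  set me := e.order.toNat with hme
  have hma1 : 1 ≤ ma := one_le_order_toNat ha ha0
  have hme1 : 1 ≤ me := one_le_order_toNat he he0
  obtain ⟨d, hd⟩ : ∃ d, mb = ma + d + 1 := Nat.exists_eq_add_of_lt hord
  set Dt := B * ((ma : ℂ⟦X⟧) * A + thetaPS A) - A * ((mb : ℂ⟦X⟧) * B + thetaPS B) with hDt
  clear_value Dt
  have hD : b * thetaPS a - a * thetaPS b = PowerSeries.X ^ (ma + mb) * Dt := by
    rw [haA, hbB, thetaPS_X_pow_mul, thetaPS_X_pow_mul, hDt]; ring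
  have hDt0 : constantCoeff Dt ≠ 0 := by
    have hne : (ma : ℂ) ≠ mb := by
      intro h; have := (Nat.cast_injective h : ma = mb); omega
    rw [hDt]
    simp only [map_sub, map_mul, map_add, map_natCast, constantCoeff_thetaPS, add_zero]
    intro h
    apply hne
    have h' : ((ma : ℂ) - mb) * (constantCoeff A * constantCoeff B) = 0 := by
      linear_combination h
    rcases mul_eq_zero.mp h' with h1 | h1
    · exact (sub_eq_zero.mp h1)
    · exact absurd h1 (mul_ne_zero hA0 hB0)
  -- Step 1: the ODE compares `X^{2ma+2mb} D̃²` with `X^{2me+mb+3ma}·4E²B·C̃`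
  set Ct := A ^ 3 + C a₄ * PowerSeries.X ^ (2 * (d + 1)) * A * B ^ 2 +
    C a₆ * PowerSeries.X ^ (3 * (d + 1)) * B ^ 3 with hCt
  clear_value Ct
  have hCt0 : constantCoeff Ct ≠ 0 := by
    rw [hCt]
    simp only [map_add, map_mul, map_pow, constantCoeff_C, constantCoeff_X, ne_eq]
    rw [zero_pow (by omega), zero_pow (by omega)]
    simpa using pow_ne_zero 3 hA0
  have hcubic : a ^ 3 + C a₄ * a * b ^ 2 + C a₆ * b ^ 3 = PowerSeries.X ^ (3 * ma) * Ct := by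
    rw [haA, hbB, hCt, hd]; ring
  have hode' : PowerSeries.X ^ (2 * (ma + mb)) * Dt ^ 2 =
      PowerSeries.X ^ (2 * me + mb + 3 * ma) * (4 * E ^ 2 * B * Ct) := by
    have := hode
    rw [hD, hcubic, heE, hbB] at this
    linear_combination this
  have hunits1 : constantCoeff (Dt ^ 2) ≠ 0 := by rw [map_pow]; exact pow_ne_zero 2 hDt0
  have hunits2 : constantCoeff (4 * E ^ 2 * B * Ct) ≠ 0 := by
    simp only [map_mul, map_pow, map_ofNat]
    exact mul_ne_zero (mul_ne_zero (mul_ne_zero (by norm_num) (pow_ne_zero 2 hE0)) hB0) hCt0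
  have hexp : 2 * (ma + mb) = 2 * me + mb + 3 * ma := eq_of_X_pow_mul_eq_X_pow_mul hunits1 hunits2 hode'
  have hDt2 : Dt ^ 2 = 4 * E ^ 2 * B * Ct := eq_of_X_pow_mul_eq_X_pow_mul' hunits1 hunits2 hode'
  have hd2 : d + 1 = 2 * me := by omega
  -- Step 2: `z = X^{me} Z̃` with `Z̃ D̃ = −2ABE`
  set Zt := -2 * A * B * E * Dt⁻¹ with hZt
  clear_value Zt
  have hZD : Zt * Dt = -2 * A * B * E := by
    rw [hZt, mul_assoc, PowerSeries.inv_mul_cancel _ hDt0, mul_one]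
  have hzZ : z = PowerSeries.X ^ me * Zt := by
    have h1 : PowerSeries.X ^ (ma + mb) * (z * Dt) =
        PowerSeries.X ^ (ma + mb) * (PowerSeries.X ^ me * Zt * Dt) := by
      have := hz
      rw [hD, haA, hbB, heE] at this
      linear_combination this - PowerSeries.X ^ (ma + mb) * PowerSeries.X ^ me * hZD
    have h2 : z * Dt = PowerSeries.X ^ me * Zt * Dt := X_pow_mul_cancel h1
    have hDtne : Dt ≠ 0 := fun h ↦ hDt0 (by rw [h, map_zero])
    exact mul_right_cancel₀ hDtne h2
  have hz0 : constantCoeff z = 0 := by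
    rw [hzZ, map_mul, map_pow, constantCoeff_X, zero_pow (by omega), zero_mul]
  have hzs : HasSubst z := HasSubst.of_constantCoeff_zero' hz0
  -- Step 3: the `(QC)` relation `Z̃² C̃ = A² B`
  have hQC : Zt ^ 2 * Ct = A ^ 2 * B := by
    have hEBC : 4 * E ^ 2 * B * Ct ≠ 0 := fun h ↦ hunits2 (by rw [h, map_zero])
    have key : (Zt ^ 2 * Ct - A ^ 2 * B) * (4 * E ^ 2 * B * Ct) = 0 := by
      linear_combination (-Ct * Zt ^ 2) * hDt2 + Ct * (Zt * Dt - 2 * A * B * E) * hZD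
    exact sub_eq_zero.mp ((mul_eq_zero.mp key).resolve_right hEBC)
  -- Step 4: `b·X_E(z) = z²·a`
  set P := W.formalXMulSq.subst z with hP
  clear_value P
  have hP0 : constantCoeff P = 1 := by
    rw [hP, constantCoeff_subst_of_zero hz0, WeierstrassCurve.constantCoeff_formalXMulSq]
  have hPeq : P ^ 2 = P ^ 3 + C a₄ * z ^ 4 * P + C a₆ * z ^ 6 := by
    have h := W.formalXMulSq_sq_eq
    have h1 : W.a₁ = 0 := rfl
    have h2 : W.a₂ = 0 := rfl
    have h3 : W.a₃ = 0 := rfl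
    have h4 : W.a₄ = a₄ := rfl
    have h6 : W.a₆ = a₆ := rfl
    rw [h1, h2, h3, h4, h6, map_zero] at h
    simp only [zero_mul, add_zero] at h
    have h' := congrArg (PowerSeries.subst z) h
    simp only [subst_pow hzs, subst_add hzs, subst_mul hzs, subst_X hzs, subst_C' hzs] at h'
    rw [hP]
    linear_combination h'
  set Q := Zt ^ 2 * A * B⁻¹ with hQ
  clear_value Q
  have hBinv : B * B⁻¹ = 1 := PowerSeries.mul_inv_cancel _ hB0
  have hBQ : B * Q = Zt ^ 2 * A := by
    rw [hQ]; linear_combination Zt ^ 2 * A * hBinv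
  have hQ0 : constantCoeff Q = 1 := by
    have hγ : constantCoeff Ct = constantCoeff A ^ 3 := by
      rw [hCt]
      simp only [map_add, map_mul, map_pow, constantCoeff_C, constantCoeff_X]
      rw [zero_pow (by omega), zero_pow (by omega)]
      ring
    have h1 := congrArg constantCoeff hBQ
    have h2 := congrArg constantCoeff hQC
    simp only [map_mul, map_pow] at h1 h2
    rw [hγ] at h2
    have h3 : constantCoeff Zt ^ 2 * constantCoeff A = constantCoeff B := by
      have : (constantCoeff Zt ^ 2 * constantCoeff A - constantCoeff B) * constantCoeff A ^ 2 = 0 := by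
        linear_combination h2
      exact sub_eq_zero.mp ((mul_eq_zero.mp this).resolve_right (pow_ne_zero 2 hA0))
    rw [h3] at h1
    refine mul_left_cancel₀ hB0 ?_
    rw [mul_one]
    exact h1
  have hQeq : Q ^ 2 = Q ^ 3 + C a₄ * z ^ 4 * Q + C a₆ * z ^ 6 := by
    have hB3 : B ^ 3 ≠ 0 := pow_ne_zero 3 (fun h ↦ hB0 (by rw [h, map_zero]))
    have key : B ^ 3 * (Q ^ 2 - (Q ^ 3 + C a₄ * z ^ 4 * Q + C a₆ * z ^ 6)) = 0 := by
      rw [hzZ]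
      have hCt' : Ct = A ^ 3 + C a₄ * PowerSeries.X ^ (4 * me) * A * B ^ 2 +
          C a₆ * PowerSeries.X ^ (6 * me) * B ^ 3 := by
        rw [hCt, hd2]; ring_nf
      linear_combination (B * (B * Q + Zt ^ 2 * A) - ((B * Q) ^ 2 + B * Q * Zt ^ 2 * A + Zt ^ 4 * A ^ 2) -
        C a₄ * (PowerSeries.X ^ me * Zt) ^ 4 * B ^ 2) * hBQ - Zt ^ 4 * hQC + Zt ^ 6 * hCt'
    exact sub_eq_zero.mp ((mul_eq_zero.mp key).resolve_left hB3)
  have hPQ : P = Q := eq_of_sq_eq_cube a₄ a₆ hz0 hP0 hQ0 hPeq hQeq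
  have hF3 : b * P = z ^ 2 * a := by
    have hmb2 : mb = ma + 2 * me := by omega
    rw [hPQ, hbB, hzZ, haA, hmb2, mul_assoc, hBQ]; ring
  -- Step 5: `X_E · w = z³`, hence `b·z³ = z²·a·w(z)` and `a·w(z) = b·z`
  have hXw : P * W.formalW.subst z = z ^ 3 := by
    have h := congrArg (PowerSeries.subst z) W.formalXMulSq_mul_formalW
    rw [subst_mul hzs, subst_pow hzs, subst_X hzs] at h
    rw [hP]
    exact h
  have htwo : (2 : ℂ⟦X⟧) ≠ 0 := by
    intro h
    have := congrArg constantCoeff h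
    rw [map_ofNat, map_zero] at this
    norm_num at this
  have hzne : z ≠ 0 := by
    rintro rfl
    rw [zero_mul] at hz
    have : (-2 : ℂ⟦X⟧) * a * b * e ≠ 0 :=
      mul_ne_zero (mul_ne_zero (mul_ne_zero (neg_ne_zero.mpr htwo) ha) hb) he
    exact this hz.symm
  have key : z ^ 2 * (a * W.formalW.subst z - b * z) = 0 := by
    linear_combination b * hXw - W.formalW.subst z * hF3
  exact sub_eq_zero.mp ((mul_eq_zero.mp key).resolve_left (pow_ne_zero 2 hzne))

end Core

/-! ### The modular wrapper -/

section Modular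

variable {N : ℕ} [NeZero N] {k : ℤ}

namespace IsXPresentation

variable {f : CuspForm (Gamma0 N) 2} {L : PeriodPair} {F G : CuspForm (Gamma0 N) k}

/-- **`log_E(z(q)) = Σ aₙ(f)qⁿ/n` AND `a·w_E(z) = b·z` along the modular parametrisation.** As
`exists_formalLog_subst_eq` (`z ∈ qℂ⟦q⟧` with `z·y = −2x` in `ℂ((q))` and `log_E(z) = Σ aₙqⁿ/n`
for `E : Y² = X³ + a₄X + a₆`), with the extra conclusion that the formal `w`-coordinate of `E` at
`z` is the actual one: `a · w_E(z) = b · z` for the expansions `a, b` of `F, G` (`x = a/b`), i.e.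
`w_E(z(q)) = z/x = −1/Y(q)`. [cite: SilvermanAEC2009, IV.1.1] [cite: Honda1970, §6.2 (pp. 241–242)]
[cite: CremonaAlgorithms1997, §2.10] -/
theorem exists_formalLog_subst_eq_formalW (h : IsXPresentation f L F G) (hf : f ≠ 0) {a₄ a₆ : ℂ}
    (h₂ : L.g₂ = -4 * a₄) (h₃ : L.g₃ = -4 * a₆) :
    ∃ z : ℂ⟦X⟧, constantCoeff z = 0 ∧
      (z : LaurentSeries ℂ) * ((h.yFn hf : modularFunctionField N) : LaurentSeries ℂ) =
        -2 * ((h.xFn : modularFunctionField N) : LaurentSeries ℂ) ∧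
      ({ a₁ := 0, a₂ := 0, a₃ := 0, a₄ := a₄, a₆ := a₆ } : WeierstrassCurve ℂ).formalLog.subst z =
        PowerSeries.mk (fun n ↦ cuspCoeff f n / n) ∧
      qExpansion 1 (⇑F) *
          ({ a₁ := 0, a₂ := 0, a₃ := 0, a₄ := a₄, a₆ := a₆ } : WeierstrassCurve ℂ).formalW.subst z =
        qExpansion 1 (⇑G) * z := by
  set a := qExpansion 1 (⇑F) with ha
  set b := qExpansion 1 (⇑G) with hb
  set e := qExpansion 1 (⇑f) with he
  have hF0 : (F : ModularForm (Gamma0 N) k) ≠ 0 := h.numerator_ne_zero hf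
  have hG0 := h.modularForm_ne_zero
  have hf' : (f : ModularForm (Gamma0 N) 2) ≠ 0 := by
    intro h0; apply hf; apply DFunLike.ext; intro τ; exact DFunLike.congr_fun h0 τ
  have ha0 : a ≠ 0 := qExpansion_ne_zero_of_ne_zero hF0
  have hb0 : b ≠ 0 := qExpansion_ne_zero_of_ne_zero hG0
  have he0 : e ≠ 0 := qExpansion_ne_zero_of_ne_zero hf'
  have hac : constantCoeff a = 0 := by
    rw [← coeff_zero_eq_constantCoeff_apply, ha]
    exact CuspFormClass.qExpansion_coeff_zero F one_pos (one_mem_strictPeriods_coe_gamma0 N)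
  have hec : constantCoeff e = 0 := by
    rw [← coeff_zero_eq_constantCoeff_apply, he]
    exact CuspFormClass.qExpansion_coeff_zero f one_pos (one_mem_strictPeriods_coe_gamma0 N)
  have hord : a.order.toNat < b.order.toNat := h.qOrder_lt hf
  have hode : (b * thetaPS a - a * thetaPS b) ^ 2 =
      4 * e ^ 2 * b * (a ^ 3 + C a₄ * a * b ^ 2 + C a₆ * b ^ 3) := by
    have h0 := h.odePS_eq_zero hf
    rw [h₂, h₃, map_mul, map_mul, map_neg, map_ofNat] at h0
    rw [← ha, ← hb, ← he] at h0
    linear_combination h0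
  obtain ⟨z, hz⟩ := exists_mul_wronskian_eq e ha0 hb0 hord
  obtain ⟨hz0, hlog⟩ := formalLog_subst_eq_of_ode a₄ a₆ ha0 hb0 he0 hac hec hord hode hz
  have hw := formalW_subst_eq_of_ode a₄ a₆ ha0 hb0 he0 hac hec hord hode hz
  refine ⟨z, hz0, ?_, ?_, hw⟩
  · -- the Laurent identity `z·y = −2x`
    have hbL : ((b : ℂ⟦X⟧) : LaurentSeries ℂ) ≠ 0 := fun h0 ↦
      hb0 (HahnSeries.ofPowerSeries_injective (Γ := ℤ) (R := ℂ) (h0.trans (map_zero _).symm))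
    have heL : ((e : ℂ⟦X⟧) : LaurentSeries ℂ) ≠ 0 := fun h0 ↦
      he0 (HahnSeries.ofPowerSeries_injective (Γ := ℤ) (R := ℂ) (h0.trans (map_zero _).symm))
    have hD0 : b * thetaPS a - a * thetaPS b ≠ 0 := by
      intro h0
      rw [h0, mul_zero] at hz
      have htwo : (2 : ℂ⟦X⟧) ≠ 0 := by
        intro h
        have := congrArg constantCoeff h
        rw [map_ofNat, map_zero] at this
        norm_num at this
      exact mul_ne_zero (mul_ne_zero (mul_ne_zero (neg_ne_zero.mpr htwo) ha0) hb0) he0 hz.symm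
    have hzL : ((z : ℂ⟦X⟧) : LaurentSeries ℂ) * ((b * thetaPS a - a * thetaPS b : ℂ⟦X⟧) : LaurentSeries ℂ) =
        -2 * (a : LaurentSeries ℂ) * (b : LaurentSeries ℂ) * (e : LaurentSeries ℂ) := by
      rw [← PowerSeries.coe_mul, hz]
      simp only [PowerSeries.coe_mul, PowerSeries.coe_neg, map_ofNat]
    have hx : ((h.xFn : modularFunctionField N) : LaurentSeries ℂ) =
        (a : LaurentSeries ℂ) / (b : LaurentSeries ℂ) := rfl
    rw [h.coe_yFn hf, hx, ← ha, ← hb, ← he, PowerSeries.coe_mul, PowerSeries.coe_mul,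
      mul_div_assoc']
    rw [div_eq_iff (mul_ne_zero (mul_ne_zero hbL hbL) heL), hzL]
    field_simp
  · rw [hlog]
    rfl

/-- **Bounded denominators of `z` AND of `w_E(z)`.** In the setting of
`exists_int_series_of_mul_yFn_eq` (`f ≠ 0` with integral coefficients, `g₂(L), g₃(L) ∈ ℚ`, a
presentation of weight `k ≥ 2`), a series `z ∈ ℂ⟦q⟧` with `z·y = −2x` and `a·w_E(z) = b·z` for
`E : Y² = X³ + a₄X + a₆`, `a₄, a₆ ∈ ℚ` (as produced by `exists_formalLog_subst_eq_formalW`) has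
rational coefficients, `z = z_ℚ`, and there are `P, Q, P₂, Q₂ ∈ ℤ⟦q⟧`, `Q, Q₂ ≠ 0`, with
`z_ℚ·Q = P` and `w_{E_ℚ}(z_ℚ)·Q₂ = P₂` (namely `Q₂ = D₁AQ`, `P₂ = D₂BP` for a rational presentation
`x = a₁/b₁`, `A = D₂a₁, B = D₁b₁ ∈ ℤ⟦q⟧`, since `a₁·w = b₁·z`). [cite: ShimuraIATAF1971, Thm. 3.52]
[cite: Honda1970, §6.2 (p. 241)] -/
theorem exists_int_series_formalW_of_mul_yFn_eq (h : IsXPresentation f L F G) (hf : f ≠ 0) (hk : 2 ≤ k)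
    (hint : ∀ n, ∃ m : ℤ, (m : ℂ) = cuspCoeff f n) {a₄ a₆ : ℚ} (h₂ : L.g₂ = -4 * (a₄ : ℂ))
    (h₃ : L.g₃ = -4 * (a₆ : ℂ)) {z : ℂ⟦X⟧} (hz0 : constantCoeff z = 0)
    (hz : (z : LaurentSeries ℂ) * ((h.yFn hf : modularFunctionField N) : LaurentSeries ℂ) =
      -2 * ((h.xFn : modularFunctionField N) : LaurentSeries ℂ))
    (hw : qExpansion 1 (⇑F) *
        ({ a₁ := 0, a₂ := 0, a₃ := 0, a₄ := (a₄ : ℂ), a₆ := (a₆ : ℂ) } : WeierstrassCurve ℂ).formalW.subst z =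
      qExpansion 1 (⇑G) * z) :
    ∃ (zq : ℚ⟦X⟧) (P Q P₂ Q₂ : ℤ⟦X⟧), zq.map (algebraMap ℚ ℂ) = z ∧ Q ≠ 0 ∧
      zq * Q.map (Int.castRingHom ℚ) = P.map (Int.castRingHom ℚ) ∧ Q₂ ≠ 0 ∧
      ({ a₁ := 0, a₂ := 0, a₃ := 0, a₄ := a₄, a₆ := a₆ } : WeierstrassCurve ℚ).formalW.subst zq *
          Q₂.map (Int.castRingHom ℚ) = P₂.map (Int.castRingHom ℚ) := by
  classical
  have hg₂ : ∃ q : ℚ, (q : ℂ) = L.g₂ := ⟨-4 * a₄, by push_cast; exact h₂.symm⟩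
  have hg₃ : ∃ q : ℚ, (q : ℂ) = L.g₃ := ⟨-4 * a₆, by push_cast; exact h₃.symm⟩
  obtain ⟨zq, P, Q, hzq, hQ, hPQ⟩ := h.exists_int_series_of_mul_yFn_eq hf hk hint hg₂ hg₃ hz
  have hrat : ∀ n, ∃ q : ℚ, (q : ℂ) = cuspCoeff f n := fun n ↦ by
    obtain ⟨m, hm⟩ := hint n; exact ⟨m, by rw [← hm]; push_cast; rfl⟩
  obtain ⟨F₁, G₁, D₁, D₂, hG₁0, hD₁, hD₂, hF₁, hD₁int, hD₂int⟩ :=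
    h.exists_rat_presentation hf hk hrat hg₂ hg₃
  set W : WeierstrassCurve ℂ :=
    { a₁ := 0, a₂ := 0, a₃ := 0, a₄ := (a₄ : ℂ), a₆ := (a₆ : ℂ) } with hW
  set Wq : WeierstrassCurve ℚ := { a₁ := 0, a₂ := 0, a₃ := 0, a₄ := a₄, a₆ := a₆ } with hWq
  set a := qExpansion 1 (⇑F) with ha
  set b := qExpansion 1 (⇑G) with hb
  set a₁ := qExpansion 1 (⇑F₁) with ha₁
  set b₁ := qExpansion 1 (⇑G₁) with hb₁
  set w := W.formalW.subst z with hwdef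
  have hF0 : (F : ModularForm (Gamma0 N) k) ≠ 0 := h.numerator_ne_zero hf
  have hG₁0' : (G₁ : ModularForm (Gamma0 N) k) ≠ 0 := by
    intro h0; apply hG₁0; apply DFunLike.ext; intro τ; exact DFunLike.congr_fun h0 τ
  have ha0 : a ≠ 0 := qExpansion_ne_zero_of_ne_zero hF0
  have hb0 : b ≠ 0 := qExpansion_ne_zero_of_ne_zero h.modularForm_ne_zero
  have hb₁0 : b₁ ≠ 0 := qExpansion_ne_zero_of_ne_zero hG₁0'
  have inj : Function.Injective (fun p : ℂ⟦X⟧ ↦ (p : LaurentSeries ℂ)) :=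
    HahnSeries.ofPowerSeries_injective
  -- `a₁ b = b₁ a`, hence `a₁ ≠ 0` and `a₁ w = b₁ z`
  have hR : a₁ * b = b₁ * a := by
    apply inj
    change ((a₁ * b : ℂ⟦X⟧) : LaurentSeries ℂ) = ((b₁ * a : ℂ⟦X⟧) : LaurentSeries ℂ)
    rw [PowerSeries.coe_mul, PowerSeries.coe_mul, ← hF₁, ← h.coe_xFn_mul]
    ring
  have ha₁0 : a₁ ≠ 0 := by
    intro h0
    rw [h0, zero_mul] at hR
    exact mul_ne_zero hb₁0 ha0 hR.symm
  have hR₁ : a₁ * w = b₁ * z := by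
    have key : b * (a₁ * w - b₁ * z) = 0 := by linear_combination w * hR + b₁ * hw
    exact sub_eq_zero.mp ((mul_eq_zero.mp key).resolve_left hb0)
  -- integral models `A = D₂ a₁`, `B = D₁ b₁`
  obtain ⟨A, hA⟩ := exists_int_series_of_int_mul_cuspCoeff hD₂int
  obtain ⟨B, hB⟩ := exists_int_series_of_int_mul_cuspCoeff hD₁int
  rw [← ha₁] at hA
  rw [← hb₁] at hB
  set Q₂ : ℤ⟦X⟧ := C (D₁ : ℤ) * A * Q with hQ₂
  set P₂ : ℤ⟦X⟧ := C (D₂ : ℤ) * B * P with hP₂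
  have hmm : ∀ φ : ℤ⟦X⟧, (φ.map (Int.castRingHom ℚ)).map (algebraMap ℚ ℂ) = φ.map (Int.castRingHom ℂ) := by
    intro φ; ext n; simp [coeff_map]
  -- the identity over `ℂ`: `w · Q₂ = P₂`
  have hzQC : z * Q.map (Int.castRingHom ℂ) = P.map (Int.castRingHom ℂ) := by
    rw [← hmm, ← hmm, ← hzq, ← map_mul, hPQ]
  have e1 : Q₂.map (Int.castRingHom ℂ) = C (D₁ : ℂ) * (C (D₂ : ℂ) * a₁) * Q.map (Int.castRingHom ℂ) := by
    rw [hQ₂, map_mul, map_mul, map_C, eq_intCast, Int.cast_natCast, hA]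
  have e2 : P₂.map (Int.castRingHom ℂ) = C (D₂ : ℂ) * (C (D₁ : ℂ) * b₁) * P.map (Int.castRingHom ℂ) := by
    rw [hP₂, map_mul, map_mul, map_C, eq_intCast, Int.cast_natCast, hB]
  have hwQ : w * Q₂.map (Int.castRingHom ℂ) = P₂.map (Int.castRingHom ℂ) := by
    rw [e1, e2, ← hzQC]
    linear_combination (C (D₁ : ℂ) * C (D₂ : ℂ) * Q.map (Int.castRingHom ℂ)) * hR₁
  have hA0 : A ≠ 0 := by
    intro h0
    have : C (D₂ : ℂ) * a₁ = 0 := by rw [← hA, h0, map_zero]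
    rcases mul_eq_zero.mp this with h1 | h1
    · exact (show (D₂ : ℂ) ≠ 0 by exact_mod_cast hD₂.ne') (by simpa using congrArg constantCoeff h1)
    · exact ha₁0 h1
  have hQ₂0 : Q₂ ≠ 0 := by
    rw [hQ₂]
    refine mul_ne_zero (mul_ne_zero ?_ hA0) hQ
    intro h0
    have h := congrArg constantCoeff h0
    rw [constantCoeff_C, map_zero, Nat.cast_eq_zero] at h
    exact hD₁.ne' h
  refine ⟨zq, P, Q, P₂, Q₂, hzq, hQ, hPQ, hQ₂0, ?_⟩
  -- descend `w · Q₂ = P₂` to `ℚ⟦q⟧`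
  have hzq0 : constantCoeff zq = 0 := by
    have h0 := hz0
    rw [← hzq, ← coeff_zero_eq_constantCoeff, coeff_map, coeff_zero_eq_constantCoeff] at h0
    exact (map_eq_zero (algebraMap ℚ ℂ)).mp h0
  have hzqs : HasSubst zq := HasSubst.of_constantCoeff_zero' hzq0
  have hmapW : Wq.map (algebraMap ℚ ℂ) = W := by simp [hWq, hW, WeierstrassCurve.map]
  have hinj : Function.Injective (PowerSeries.map (algebraMap ℚ ℂ)) := by
    intro u v huv
    ext n
    have := congrArg (coeff n) huv
    rw [coeff_map, coeff_map] at this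
    exact (algebraMap ℚ ℂ).injective this
  apply hinj
  rw [map_mul, powerSeries_map_subst hzqs (algebraMap ℚ ℂ), WeierstrassCurve.map_formalW, hmapW, hzq,
    hmm, hmm, ← hwdef]
  exact hwQ

end IsXPresentation

/-- **The modular parametrisation at `∞` in formal terms, with the `w`-coordinate.** For a nonzero
`f ∈ S₂(Γ₀(N))` with integral coefficients `aₙ`, a period pair `L` with `Λ(L) ⊇ Λ_f` and
`g₂(L) = −4a₄`, `g₃(L) = −4a₆`, `a₄, a₆ ∈ ℚ`, there is `z ∈ ℚ⟦q⟧` with `z(0) = 0`,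
`log_E(z) = Σ aₙqⁿ/n` for `E : y² = x³ + a₄x + a₆` over `ℚ`, and BOTH `z` and `w_E(z)` have
bounded denominators: `z·Q = P`, `w_E(z)·Q₂ = P₂` with `P, Q, P₂, Q₂ ∈ ℤ⟦q⟧`, `Q, Q₂ ≠ 0`
(`exists_rat_series_formalLog_subst_eq` of `EichlerShimuraCongruenceHondaProofs` plus the
`x,y`-dictionary `w_E(z) = −1/Y`). [Honda 1970, §6.2 (6.8)–(6.9)] [cite: ShimuraIATAF1971, Thm. 7.14]
[cite: SilvermanAEC2009, IV.1.1] -/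
theorem exists_rat_series_formalLog_subst_eq_formalW {N : ℕ} [NeZero N] (f : CuspForm (Gamma0 N) 2)
    (hf : f ≠ 0) (a : ℕ → ℤ) (ha : ∀ n, (a n : ℂ) = cuspCoeff f n) (L : PeriodPair)
    (hΛ : ∀ x ∈ periodLattice f, x ∈ L.lattice) (a₄ a₆ : ℚ) (h₂ : L.g₂ = -4 * (a₄ : ℂ))
    (h₃ : L.g₃ = -4 * (a₆ : ℂ)) :
    ∃ (z : ℚ⟦X⟧) (P Q P₂ Q₂ : ℤ⟦X⟧), constantCoeff z = 0 ∧ Q ≠ 0 ∧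
      z * Q.map (Int.castRingHom ℚ) = P.map (Int.castRingHom ℚ) ∧ Q₂ ≠ 0 ∧
      ({ a₁ := 0, a₂ := 0, a₃ := 0, a₄ := a₄, a₆ := a₆ } : WeierstrassCurve ℚ).formalW.subst z *
          Q₂.map (Int.castRingHom ℚ) = P₂.map (Int.castRingHom ℚ) ∧
      ({ a₁ := 0, a₂ := 0, a₃ := 0, a₄ := a₄, a₆ := a₆ } : WeierstrassCurve ℚ).formalLog.subst z =
        PowerSeries.mk fun n ↦ (a n : ℚ) / n := by
  obtain ⟨k, F, G, hk, hX⟩ := exists_isXPresentation f hf L hΛ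
  obtain ⟨zc, hzc0, hzy, hlog, hw⟩ := hX.exists_formalLog_subst_eq_formalW hf h₂ h₃
  have hint : ∀ n, ∃ m : ℤ, (m : ℂ) = cuspCoeff f n := fun n => ⟨a n, ha n⟩
  obtain ⟨z, P, Q, P₂, Q₂, hz, hQ, hPQ, hQ₂, hPQ₂⟩ :=
    hX.exists_int_series_formalW_of_mul_yFn_eq hf (by omega) hint h₂ h₃ hzc0 hzy hw
  have hz0 : constantCoeff z = 0 := by
    have h0 := hzc0
    rw [← hz, ← coeff_zero_eq_constantCoeff, coeff_map, coeff_zero_eq_constantCoeff] at h0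
    exact (map_eq_zero (algebraMap ℚ ℂ)).mp h0
  refine ⟨z, P, Q, P₂, Q₂, hz0, hQ, hPQ, hQ₂, hPQ₂, ?_⟩
  apply PowerSeries.map_injective (algebraMap ℚ ℂ) (algebraMap ℚ ℂ).injective
  set W₀ : WeierstrassCurve ℚ := { a₁ := 0, a₂ := 0, a₃ := 0, a₄ := a₄, a₆ := a₆ } with hW₀
  have hmapW : W₀.map (algebraMap ℚ ℂ) = ({ a₁ := 0, a₂ := 0, a₃ := 0, a₄ := (a₄ : ℂ), a₆ := (a₆ : ℂ) } :
      WeierstrassCurve ℂ) := by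
    simp [hW₀, WeierstrassCurve.map]
  have hzs : HasSubst z := HasSubst.of_constantCoeff_zero' hz0
  rw [powerSeries_map_subst hzs (algebraMap ℚ ℂ), W₀.map_formalLog (algebraMap ℚ ℂ), hmapW, hz, hlog]
  ext n
  rw [coeff_map, coeff_mk, coeff_mk, map_div₀, map_natCast, eq_ratCast, Rat.cast_intCast, ha]

end Modular

end Literature.NumberTheory.EllipticCurves.ModularForms

/-! ### Transport along an admissible change of variables over `ℚ` -/

namespace WeierstrassCurve

open PowerSeries Literature.NumberTheory.EllipticCurves

section LogTransport

variable {A : Type*} [CommRing A] [Algebra ℚ A] [IsAddTorsionFree A]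
  (E : WeierstrassCurve A) (vc : VariableChange A)

/-- **`log_{vc • E}(θ_vc(z)) = u · log_E(z)`** for every `z ∈ XA⟦X⟧`
(`formalLog_variableChange_subst` read through `z`). [cite: SilvermanAEC2009, IV.5.5] -/
theorem formalLog_subst_formalVariableChange_subst {z : A⟦X⟧} (hz : constantCoeff z = 0) :
    (vc • E).formalLog.subst ((E.formalVariableChange vc).subst z) =
      C (vc.u : A) * E.formalLog.subst z := by
  have hzs : HasSubst z := HasSubst.of_constantCoeff_zero' hz
  have h := congrArg (PowerSeries.subst z) (E.formalLog_variableChange_subst vc)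
  rw [subst_comp_subst_apply (E.hasSubst_formalVariableChange vc) hzs, subst_mul hzs, C_subst] at h
  exact h

end LogTransport

section FracTransport

variable (E : WeierstrassCurve ℚ) (vc : VariableChange ℚ)

/-- `θ(z)·den(z) = u·(z − r·w(z))` read through `z`. [folklore] -/
theorem formalVariableChange_subst_mul_denom {z : ℚ⟦X⟧} (hz : constantCoeff z = 0) :
    (E.formalVariableChange vc).subst z *
        (1 + C vc.s * z + C (vc.t - vc.s * vc.r) * E.formalW.subst z) =
      C (vc.u : ℚ) * (z - C vc.r * E.formalW.subst z) := by
  have hzs : HasSubst z := HasSubst.of_constantCoeff_zero' hz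
  have h := congrArg (substAlgHom hzs) (E.formalVariableChange_mul_denom vc)
  simp only [formalVariableChangeDenom, map_mul, map_add, map_sub, map_one] at h
  simp only [coe_substAlgHom, subst_X hzs, C_subst] at h
  simpa only [map_sub, map_mul] using h

/-- **Transport of bounded denominators along a change of variables.** Let `E/ℚ` be a Weierstrass
curve, `vc = (u, r, s, t)` an admissible change of variables over `ℚ`, and `z ∈ Xℚ⟦X⟧` such that
both `z` and `w_E(z)` lie in `Frac ℤ⟦X⟧` (`z·Q = P`, `w_E(z)·Q₂ = P₂`, `Q, Q₂ ≠ 0`). Then the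
parameter `t' = θ_vc(z) = u(z − r w(z))/(1 + sz + (t − sr)w(z))` of `vc • E` at the transformed
point (`FormalGroupVariableChangeProofs`; `t' = −X'/Y'`) lies in `Frac ℤ⟦X⟧`: `t'·Q' = P'` with
`Q' = M·(QQ₂ + sPQ₂ + (t − sr)QP₂)`, `P' = M·u·(PQ₂ − rQP₂)` for a common denominator `M` of
`u, r, s, t`. [cite: SilvermanAEC2009, III.1 and IV.1] -/
theorem exists_int_frac_formalVariableChange_subst {z : ℚ⟦X⟧} (hz : constantCoeff z = 0)
    {P Q P₂ Q₂ : ℤ⟦X⟧} (hQ : Q ≠ 0) (hPQ : z * Q.map (Int.castRingHom ℚ) = P.map (Int.castRingHom ℚ))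
    (hQ₂ : Q₂ ≠ 0)
    (hPQ₂ : E.formalW.subst z * Q₂.map (Int.castRingHom ℚ) = P₂.map (Int.castRingHom ℚ)) :
    ∃ P' Q' : ℤ⟦X⟧, Q' ≠ 0 ∧
      (E.formalVariableChange vc).subst z * Q'.map (Int.castRingHom ℚ) = P'.map (Int.castRingHom ℚ) := by
  have key := E.formalVariableChange_subst_mul_denom vc hz
  have hw0 : constantCoeff (E.formalW.subst z) = 0 := by
    rw [constantCoeff_subst_eq_constantCoeff hz, E.constantCoeff_formalW]
  set u : ℚ := (vc.u : ℚ) with hu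
  set r : ℚ := vc.r with hr
  set s : ℚ := vc.s with hs
  set t : ℚ := vc.t with ht
  set w := E.formalW.subst z with hw
  set θz := (E.formalVariableChange vc).subst z with hθz
  set Qq := Q.map (Int.castRingHom ℚ) with hQq
  set Pq := P.map (Int.castRingHom ℚ) with hPq
  set Q₂q := Q₂.map (Int.castRingHom ℚ) with hQ₂q
  set P₂q := P₂.map (Int.castRingHom ℚ) with hP₂q
  -- a common denominator `M = dᵤ d_r d_s d_t` and the integers `M s`, `M t`, `M s r`, `M u`, `M u r`
  set M : ℤ := u.den * r.den * s.den * t.den with hM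
  set ns : ℤ := s.num * u.den * r.den * t.den with hns
  set nt : ℤ := t.num * u.den * r.den * s.den with hnt
  set nsr : ℤ := s.num * r.num * u.den * t.den with hnsr
  set nu : ℤ := u.num * r.den * s.den * t.den with hnu
  set nur : ℤ := u.num * r.num * s.den * t.den with hnur
  have hdu : (u.den : ℚ) * u = u.num := by rw [mul_comm]; exact Rat.mul_den_eq_num u
  have hdr : (r.den : ℚ) * r = r.num := by rw [mul_comm]; exact Rat.mul_den_eq_num r
  have hds : (s.den : ℚ) * s = s.num := by rw [mul_comm]; exact Rat.mul_den_eq_num s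
  have hdt : (t.den : ℚ) * t = t.num := by rw [mul_comm]; exact Rat.mul_den_eq_num t
  have eM : ((M : ℤ) : ℚ) = u.den * r.den * s.den * t.den := by rw [hM]; push_cast; ring
  have ens : ((ns : ℤ) : ℚ) = (M : ℚ) * s := by
    rw [hns, eM]; push_cast; linear_combination -((u.den : ℚ) * r.den * t.den) * hds
  have ent : ((nt : ℤ) : ℚ) = (M : ℚ) * t := by
    rw [hnt, eM]; push_cast; linear_combination -((u.den : ℚ) * r.den * s.den) * hdt
  have ensr : ((nsr : ℤ) : ℚ) = (M : ℚ) * s * r := by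
    rw [hnsr, eM]; push_cast
    linear_combination -((u.den : ℚ) * t.den * r.num) * hds - ((u.den : ℚ) * t.den * s.den * s) * hdr
  have enu : ((nu : ℤ) : ℚ) = (M : ℚ) * u := by
    rw [hnu, eM]; push_cast; linear_combination -((r.den : ℚ) * s.den * t.den) * hdu
  have enur : ((nur : ℤ) : ℚ) = (M : ℚ) * u * r := by
    rw [hnur, eM]; push_cast
    linear_combination -((s.den : ℚ) * t.den * r.num) * hdu - ((s.den : ℚ) * t.den * u.den * u) * hdr
  -- the witnesses
  refine ⟨C nu * P * Q₂ - C nur * Q * P₂, C M * Q * Q₂ + C ns * P * Q₂ + C (nt - nsr) * Q * P₂, ?_, ?_⟩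
  · -- `Q' ≠ 0`: its image in `ℚ⟦X⟧` is `M · Q · Q₂ · den(z)` with `den(z)(0) = 1`
    intro h0
    have h0' := congrArg (PowerSeries.map (Int.castRingHom ℚ)) h0
    rw [map_zero] at h0'
    have hden : (PowerSeries.map (Int.castRingHom ℚ))
        (C M * Q * Q₂ + C ns * P * Q₂ + C (nt - nsr) * Q * P₂) =
        C (M : ℚ) * Qq * Q₂q * (1 + C s * z + C (t - s * r) * w) := by
      simp only [map_add, map_mul, map_sub, map_C, ← hQq, ← hPq, ← hQ₂q, ← hP₂q]
      simp only [eq_intCast]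
      rw [ens, ent, ensr]
      simp only [map_mul]
      linear_combination (C (M : ℚ) * C s * Q₂q) * hPQ.symm +
        (C (M : ℚ) * (C t - C s * C r) * Qq) * hPQ₂.symm
    rw [hden] at h0'
    have hM0 : (M : ℚ) ≠ 0 := by
      rw [eM]
      exact_mod_cast mul_ne_zero (mul_ne_zero (mul_ne_zero u.den_nz r.den_nz) s.den_nz) t.den_nz
    have hQq0 : Qq ≠ 0 := fun h ↦ hQ (PowerSeries.map_injective (Int.castRingHom ℚ) Int.cast_injective
      (by rw [← hQq, h, map_zero]))
    have hQ₂q0 : Q₂q ≠ 0 := fun h ↦ hQ₂ (PowerSeries.map_injective (Int.castRingHom ℚ) Int.cast_injective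
      (by rw [← hQ₂q, h, map_zero]))
    have hden0 : (1 + C s * z + C (t - s * r) * w : ℚ⟦X⟧) ≠ 0 := by
      intro h
      have h1 := congrArg constantCoeff h
      rw [map_add, map_add, map_mul, map_mul, hz, hw0] at h1
      simp at h1
    have hCM : (C (M : ℚ) : ℚ⟦X⟧) ≠ 0 := by
      intro h; apply hM0; simpa using congrArg constantCoeff h
    exact (mul_ne_zero (mul_ne_zero (mul_ne_zero hCM hQq0) hQ₂q0) hden0) h0'
  · -- the identity `t'·Q' = P'`
    simp only [map_add, map_mul, map_sub, map_C, ← hQq, ← hPq, ← hQ₂q, ← hP₂q]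
    simp only [eq_intCast]
    rw [ens, ent, ensr, enu, enur]
    simp only [map_mul, map_sub] at key ⊢
    linear_combination (C (M : ℚ) * Qq * Q₂q) * key +
      (θz * C (M : ℚ) * C s * Q₂q - C (M : ℚ) * C u * Q₂q) * hPQ.symm +
      (θz * C (M : ℚ) * (C t - C s * C r) * Qq + C (M : ℚ) * C u * C r * Qq) * hPQ₂.symm

/-- **`[X¹] θ_vc(z) = u · [X¹] z`.** [cite: SilvermanAEC2009, III.1 and IV.1] -/
theorem coeff_one_formalVariableChange_subst {R : Type*} [CommRing R] (W : WeierstrassCurve R)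
    (vc' : VariableChange R) {z : R⟦X⟧} (hz : constantCoeff z = 0) :
    coeff 1 ((W.formalVariableChange vc').subst z) = (vc'.u : R) * coeff 1 z := by
  rw [coeff_one_subst_eq_mul _ hz, coeff_one_formalVariableChange]

end FracTransport

end WeierstrassCurve
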